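import Summits.QuantumFields.BalabanUV.Beta.FP.TowerK2bDefectRooted

/-!
# `BalabanUV.Beta.FP.TowerK2bDefectBrickDoor` — binder row D1 ∕ (C1) OWNER «beta-an2», PART 37: **THE WARD DEFECT IS «FINE DOOR OF THE TRANSPORTED BRICK» MINUS
# «TRANSPORTED BRICK-LEVEL DOOR»** — the matrix shape of door (ii) (Q-FP-47-1's answer, an2 A-2 [AN2-G73-A2] on Engine C K2L-OVL 3f3ca9a4efdb6ae3) over the letters of
# road «FP» `TowerK2bDefectSplit` VERBATIM, hypothesis-free

WHY.  By value the located NO of the END wrapper's residual row (J-R₂″) is storeywise proper against BOTH candidate fine-field doors (finest `E_λ`: K2L-C ∕ K2L-SPLIT;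
best block-rooted `Ĝ_c`: K2L-OVL — the overlap word carries 35–88 % of the residual at every pair, `ρ_ovl = 0.434`); the answer to Q-FP-47-1 is door (ii): each storey's
variables are turned by the gauge function sampled at THAT storey's roots.  THIS FILE types the matrix vocabulary of door (ii) at one storey, with no hypothesis:
with the LEG MATRIX `L̂ := Matrix.of L : Matrix τ ι ℝ` (row `b` = the transport of brick `b` to the fine indices), the BRICK TABLE `H := Matrix.of h : Matrix τ τ ℝ`
and the BRICK-LEVEL generator `E_rt := diagonal (λ ∘ rt) : Matrix τ τ ℝ` (the gauge function sampled at the brick roots, acting on the BRICK index):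
§1 **`brickTable_eq_transpose_mul_mul`** — the brick-weighted transport table IS a congruence transport, `B = Σ h b₁ b₂ • L b₁ ⊗ L b₂ = L̂ᵀ·H·L̂`;
§2 **`rootWord_eq_neg_transported_brickDoor`** — the road's ROOT word IS minus the transported brick-level commutator,
`Σ ((λ(rt b₂) − λ(rt b₁))·h b₁ b₂) • L b₁ ⊗ L b₂ = −L̂ᵀ·(E_rt·H − H·E_rt)·L̂`;
§3 **`defect_eq_fineDoor_sub_brickDoor`** — HENCE `Σ_s λ s • Rs s = w•[E_λ, L̂ᵀHL̂] − w•L̂ᵀ[E_rt, H]L̂ + lower`: the defect is EXACTLY the failure of the fine door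
`[E_λ, ·]` to commute with the congruence transport `H ↦ L̂ᵀHL̂` past the brick-level door `[E_rt, ·]` — zero iff «transport then turn finely» = «turn at the brick
level then transport» on `H`; door (ii) is the statement that the law's order-2 word at this storey is `L̂ᵀ[E_rt, H]L̂` (turn the BRICK variables), composed down
the tower by `TowerK2bDefectClosed.def_allDepths` (road, p625806); §4 **`rootedTwist_eq_fineDoor_sub_brickDoor`** — PART 36's rooted twist in the same vocabulary.
[folklore] `Matrix`∕`Finset` algebra BY NAME over abstract finite index types; no `def`, no `def … : Prop`, nothing cited, 0 sorry; nothing of Bałaban's asserted,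
valued or discharged; door (ii) is NOT typed as a law here (that is the law owner's ∕ REFEREE's — ruling request R-AN2-73-1), only its one-storey matrix word;
(J-R₂″) NOT claimed either way; 0∕4 row-D1 binders (hW ∕ hR ∕ D1Tel ∕ D1Rep); NOT (C1), NOT (T-ID), NOT D1, NEVER «G-an2-4 closed», NOT BetaPertH, NOT continuum,
NOT Clay.
HONEST DEPENDENCY (page 1, mandatory): continuum YM on T⁴ ⇐ BetaPertH ∧ nine spine estimates (0/9 proved); BetaPertH ⇐ (D1) ∧ (D4) ∧ CAP+tail;
G-an2-4 gates asym, D1 and NE2/3/4.  HONEST FRAMING (cell contract, verbatim): «discharging `BetaPertH` makes Bałaban's UV stability UNCONDITIONAL —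
a real constructive-QFT result; it is NOT the continuum limit and NOT the Clay problem.»  ABSOLUTE RULE (cell charter, verbatim): «No internally-minted
statement may enter as a cited fact. Every hypothesis is either kernel-proved in this package or a verbatim quotation of a PUBLISHED theorem with page
reference. The manuscript(s) under audit are NOT citable for their own disputed steps — they are the thing under adjudication; programme-internal
(2001/route/tribunal) claims are never citable.»  Row D1 ∕ (C1) OWNER, b2b-balaban-beta-an2 gen 73, 2026-08-28.  No existing file touched.
-/

noncomputable section

open scoped BigOperators

namespace Summit.QuantumFields.BalabanUV.Beta.FP.TowerK2bDefectBrickDoor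

open Finset Matrix
open Summit.QuantumFields.BalabanUV.Beta.FP.TowerK2bDefectSplit (defect_eq_commutator_add_root)
open Summit.QuantumFields.BalabanUV.Beta.FP.TowerK2bDefectRooted (rootedTwist_eq_commutator_add_overlap overlap_eq_root_of_unrooted)

variable {ι σ τ : Type*} [Fintype ι] [DecidableEq ι] [Fintype σ] [DecidableEq σ] [Fintype τ] [DecidableEq τ]

/-! ## §1 The brick table is a congruence transport of the brick -/

omit [Fintype ι] [DecidableEq ι] [Fintype σ] [DecidableEq σ] [DecidableEq τ] in
/-- [folklore] **`brickTable_eq_transpose_mul_mul`**: `Σ_{b₁b₂} h b₁ b₂ • L b₁ ⊗ L b₂ = L̂ᵀ·H·L̂` with `L̂ := Matrix.of L` (legs as rows) and `H := Matrix.of h`. -/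
theorem brickTable_eq_transpose_mul_mul (h : τ → τ → ℝ) (L : τ → ι → ℝ) :
    ∑ b₁, ∑ b₂, h b₁ b₂ • Matrix.vecMulVec (L b₁) (L b₂) = (Matrix.of L)ᵀ * Matrix.of h * Matrix.of L := by
  ext x z
  simp only [Matrix.sum_apply, Matrix.smul_apply, Matrix.vecMulVec_apply, smul_eq_mul, Matrix.mul_apply, Matrix.transpose_apply, Matrix.of_apply,
    Finset.sum_mul]
  rw [Finset.sum_comm]
  exact Finset.sum_congr rfl fun b₂ _ => Finset.sum_congr rfl fun b₁ _ => by ring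

/-! ## §2 The road's root word is minus the transported BRICK-LEVEL door -/

omit [Fintype ι] [DecidableEq ι] [Fintype σ] [DecidableEq σ] in
/-- [folklore] the commutator of a diagonal with any square table, entrywise: `(E_d·M − M·E_d) i j = (d i − d j)·M i j`. -/
theorem diagonal_commutator_eq_of (d : τ → ℝ) (M : Matrix τ τ ℝ) :
    Matrix.diagonal d * M - M * Matrix.diagonal d = Matrix.of (fun i j => (d i - d j) * M i j) := by
  ext i j
  simp only [Matrix.sub_apply, Matrix.diagonal_mul, Matrix.mul_diagonal, Matrix.of_apply]
  ring

omit [Fintype ι] [DecidableEq ι] [Fintype σ] [DecidableEq σ] in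
/-- [folklore] **`rootWord_eq_neg_transported_brickDoor`**: with the brick-level generator `E_rt := diagonal (λ ∘ rt)` on the BRICK index,
`Σ_{b₁b₂} ((λ(rt b₂) − λ(rt b₁))·h b₁ b₂) • L b₁ ⊗ L b₂ = −(L̂ᵀ·(E_rt·H − H·E_rt)·L̂)` — the root word of `TowerK2bDefectSplit.defect_eq_commutator_add_root` is the
brick-level commutator transported to the fine indices by the legs, with a minus sign. -/
theorem rootWord_eq_neg_transported_brickDoor (lam : σ → ℝ) (h : τ → τ → ℝ) (L : τ → ι → ℝ) (rt : τ → σ) :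
    ∑ b₁, ∑ b₂, ((lam (rt b₂) - lam (rt b₁)) * h b₁ b₂) • Matrix.vecMulVec (L b₁) (L b₂)
      = -((Matrix.of L)ᵀ * (Matrix.diagonal (fun b => lam (rt b)) * Matrix.of h - Matrix.of h * Matrix.diagonal (fun b => lam (rt b))) * Matrix.of L) := by
  rw [diagonal_commutator_eq_of]
  ext x z
  simp only [Matrix.sum_apply, Matrix.smul_apply, Matrix.vecMulVec_apply, smul_eq_mul, Matrix.neg_apply, Matrix.mul_apply, Matrix.transpose_apply,
    Matrix.of_apply, Finset.sum_mul, ← Finset.sum_neg_distrib]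
  rw [Finset.sum_comm]
  exact Finset.sum_congr rfl fun b₂ _ => Finset.sum_congr rfl fun b₁ _ => by ring

/-! ## §3 The defect = fine door of the transported brick − transported brick-level door -/

/-- [folklore] **`defect_eq_fineDoor_sub_brickDoor` — THE WARD DEFECT AS A DOOR GAP** (letters of `TowerK2bDefectSplit.defect_eq_commutator_add_root` VERBATIM on
the left; no hypothesis): `Σ_s λ s • Rs s = w • (E_λ·(L̂ᵀHL̂) − (L̂ᵀHL̂)·E_λ) − w • L̂ᵀ·(E_rt·H − H·E_rt)·L̂ + Σ_b ℓ b • Σ_s λ s • Rl s b` — the top storey of the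
defect is the fine door of the transported brick MINUS the transported brick-level door; it vanishes iff the two doors agree on `H` through the transport. -/
theorem defect_eq_fineDoor_sub_brickDoor (pr : ι → σ) (lam : σ → ℝ) (h : τ → τ → ℝ) (L : τ → ι → ℝ) (rt : τ → σ) (ℓ : τ → ℝ)
    (Rl : σ → τ → Matrix ι ι ℝ) (w : ℝ) :
    ∑ s, lam s • (w • ∑ b₁, ∑ b₂, h b₁ b₂ • (Matrix.vecMulVec (fun x => ((if pr x = s then (1 : ℝ) else 0) - (if rt b₁ = s then (1 : ℝ) else 0)) * L b₁ x) (L b₂)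
              - Matrix.vecMulVec (L b₁) (fun z => ((if pr z = s then (1 : ℝ) else 0) - (if rt b₂ = s then (1 : ℝ) else 0)) * L b₂ z))
            + ∑ b, ℓ b • Rl s b)
      = w • (Matrix.diagonal (fun x => lam (pr x)) * ((Matrix.of L)ᵀ * Matrix.of h * Matrix.of L)
              - ((Matrix.of L)ᵀ * Matrix.of h * Matrix.of L) * Matrix.diagonal (fun x => lam (pr x)))
        - w • ((Matrix.of L)ᵀ * (Matrix.diagonal (fun b => lam (rt b)) * Matrix.of h - Matrix.of h * Matrix.diagonal (fun b => lam (rt b))) * Matrix.of L)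
        + ∑ b, ℓ b • ∑ s, lam s • Rl s b := by
  rw [defect_eq_commutator_add_root, rootWord_eq_neg_transported_brickDoor, brickTable_eq_transpose_mul_mul, smul_neg, ← sub_eq_add_neg]

/-- [folklore] **`topDefect_eq_smul_doorGap` — THE TOP STOREY ALONE** (§3 with the `ℓ`-weighted lower defects set to zero): the top word of the defect is
`w •` the DOOR GAP `[E_λ, L̂ᵀHL̂] − L̂ᵀ[E_rt, H]L̂`; in particular it vanishes iff the fine door of the transported brick equals the transported brick-level door
(for `w ≠ 0`; not restated). -/
theorem topDefect_eq_smul_doorGap (pr : ι → σ) (lam : σ → ℝ) (h : τ → τ → ℝ) (L : τ → ι → ℝ) (rt : τ → σ) (w : ℝ) :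
    ∑ s, lam s • (w • ∑ b₁, ∑ b₂, h b₁ b₂ • (Matrix.vecMulVec (fun x => ((if pr x = s then (1 : ℝ) else 0) - (if rt b₁ = s then (1 : ℝ) else 0)) * L b₁ x) (L b₂)
              - Matrix.vecMulVec (L b₁) (fun z => ((if pr z = s then (1 : ℝ) else 0) - (if rt b₂ = s then (1 : ℝ) else 0)) * L b₂ z)))
      = w • ((Matrix.diagonal (fun x => lam (pr x)) * ((Matrix.of L)ᵀ * Matrix.of h * Matrix.of L)
              - ((Matrix.of L)ᵀ * Matrix.of h * Matrix.of L) * Matrix.diagonal (fun x => lam (pr x)))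
            - (Matrix.of L)ᵀ * (Matrix.diagonal (fun b => lam (rt b)) * Matrix.of h - Matrix.of h * Matrix.diagonal (fun b => lam (rt b))) * Matrix.of L) := by
  have key := defect_eq_fineDoor_sub_brickDoor pr lam h L rt (fun _ => (0 : ℝ)) (fun _ _ => (0 : Matrix ι ι ℝ)) w
  simp only [Finset.sum_const_zero, add_zero, smul_zero] at key
  rw [key]
  simp only [smul_sub]

/-! ## §4 PART 36's rooted twist in the same vocabulary -/

omit [Fintype σ] [DecidableEq σ] in
/-- [folklore] **`rootedTwist_eq_fineDoor_sub_brickDoor`**: the rooted twist of PART 36 (`TowerK2bDefectRooted.defect_eq_rooted_twist`'s right side, per unit weight)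
`Σ h b₁ b₂ • (G_{b₁}·(L b₁ ⊗ L b₂) − (L b₁ ⊗ L b₂)·G_{b₂})` equals `[E_λ, L̂ᵀHL̂] − L̂ᵀ[E_rt, H]L̂` — PART 36 §2 at the unrooted field, read through §1–§2. -/
theorem rootedTwist_eq_fineDoor_sub_brickDoor (pr : ι → σ) (lam : σ → ℝ) (h : τ → τ → ℝ) (L : τ → ι → ℝ) (rt : τ → σ) :
    ∑ b₁, ∑ b₂, h b₁ b₂ • (Matrix.diagonal (fun x => lam (pr x) - lam (rt b₁)) * Matrix.vecMulVec (L b₁) (L b₂)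
        - Matrix.vecMulVec (L b₁) (L b₂) * Matrix.diagonal (fun z => lam (pr z) - lam (rt b₂)))
      = (Matrix.diagonal (fun x => lam (pr x)) * ((Matrix.of L)ᵀ * Matrix.of h * Matrix.of L)
          - ((Matrix.of L)ᵀ * Matrix.of h * Matrix.of L) * Matrix.diagonal (fun x => lam (pr x)))
        - (Matrix.of L)ᵀ * (Matrix.diagonal (fun b => lam (rt b)) * Matrix.of h - Matrix.of h * Matrix.diagonal (fun b => lam (rt b))) * Matrix.of L := by
  -- the UNROOTED end of PART 36 §2: at a root field on which `λ` vanishes the single generator is `E_λ` and the overlap word is the road's root word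
  -- (`overlap_eq_root_of_unrooted`); such a field always exists after extending the site type to `σ ⊕ Unit` (roots `inl ∘ rt`, sites `inl ∘ pr`, field `inr ()`,
  -- gauge function `Sum.elim λ 0`), so no hypothesis on `λ` is needed.
  have key := rootedTwist_eq_commutator_add_overlap (σ := σ ⊕ Unit) (fun x => Sum.inl (pr x)) (fun _ => Sum.inr ()) (Sum.elim lam (fun _ => 0)) h L
    (fun b => Sum.inl (rt b))
  have hov := overlap_eq_root_of_unrooted (σ := σ ⊕ Unit) (fun _ : ι => (Sum.inr () : σ ⊕ Unit)) (Sum.elim lam (fun _ => 0)) h L (fun b => Sum.inl (rt b))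
    (fun _ => rfl)
  simp only [Sum.elim_inl, Sum.elim_inr, sub_zero] at key hov
  rw [key, hov, rootWord_eq_neg_transported_brickDoor, brickTable_eq_transpose_mul_mul, ← sub_eq_add_neg]

end Summit.QuantumFields.BalabanUV.Beta.FP.TowerK2bDefectBrickDoor

end
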